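/-
Copyright (c) 2026 the pub-hodgecm-mathlib formalisation cell (harness21).  Prover seat hodgecm-mathlib-A-p19 (g26): «S3-ram» seeding wave (LEAD F0P3a-plan (g12) T11-40 (C)∕T11-41,
owner p06 (g15)), row «RANK-CM tame-ramified twin», sub-organ (r1′)+(r1″): the RESIDUE-SQUARE-CLASS LEVEL PIECE; 2026-09-01.
-/
import Literature.NumberTheory.Automorphic.UnitaryThreeSingularUnipotentClasses   -- ★ `B₀_apply_conj_sub_one_mulVec`, `cornerUnipotent_sub_one_mulVec`, `B₀_three_apply` (singular classes `n(t)`, value sets `t·N(K)`)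
import Literature.NumberTheory.Automorphic.IntMatrixLevelConjugation              -- ★ p846475 (F0P3a-p08): `isIntMatrix_conj_iff`, `forall_v_conj_sub_one_apply_le_iff`, `forall_v_mul_sub_one_apply_le_iff` (brings `IsIntMatrix`, `coe_conj_sub_one`)
import HarnessLib

/-!
# The residue-square-class level piece of `U(3)`: an `Ad K`-stable, left-`K(ϖ²)`-stable subset of the level-`ϖ` congruence set that SEPARATES the two transvection classes
# at a ramified place

Topic `NumberTheory/Automorphic`; namespace `Literature.NumberTheory.Automorphic.UnitaryGroup`.  THEOREMS ONLY (no definition, no instance, no notation, no named fact, no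
`sorry`); kernel lane `--supports stmt-HodgeConjecture-24833`.  Cell `pub/hodgecm-mathlib` (D-0151), crux H413; road «S3-tree» residue programme «S3-res», tame-ramified sub-road
«S3-ram» seeding wave (LEAD F0P3a-plan (g12) T11-40 (C)∕T11-41; owner p06 (g15) row «RANK-CM tame-ramified twin»; obstruction note F0P3a-p08 (g18) 21:12Z, this seat 21:15Z).

THE MATHEMATICS.  Over a valued field `K` with an isometric ring endomorphism `σ` and the split hermitian form `B₀` (`J₀ = antidiag(1,1,1)`), the singular unipotent classes of
`U(σ, J₀)` are the classes of `n(t) = 1 + t·E₀₂`, `σt = −t`, indexed by `t mod N(K^×)`, and the form `x ↦ B₀(x, (g − 1)x)` of a conjugate `g` of `n(t)` takes exactly the values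
`t·N(K)` (★ `UnitaryThreeSingularUnipotentClasses`).  At an UNRAMIFIED place the two classes `[n(ϖδ)]`, `[n(δ)]` are separated by `ϖ`-LEVELS (★ ‹RANK› CM p846543).  At a
TAME-RAMIFIED place (`σϖ = −ϖ`, `σ̄ = id`, `N(K^×) ∩ 𝒪^× = (𝒪^×)²·(1 + 𝔪)`) both classes are `[n(cϖ)]`, `[n(εcϖ)]` with `c, ε` `σ`-fixed units and `ε` NOT congruent to a norm:
every integral conjugate of either has `g − 1 ≡ 0 (ϖ)` at an ODD `ϖ`-level, so no piece cut by levels alone separates them.  THE CURE is the piece (written definition-free below)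
  `P(c₀) = {k : k integral, k ≡ 1 (ϖ), ∃ x ∈ 𝒪³ ∃ y ∈ 𝒪^×, |B₀(x, (k − 1)x) − ϖ·c₀·σy·y| < |ϖ|}`
(«the level-1 residue form `x̄ ↦ B₀(x,(k−1)x)∕ϖ mod 𝔪` represents the square class of `c̄₀`»): it contains `n(c₀ϖ)` (`cornerUnipotent_mem_residueSquareClassPiece`), is stable under
conjugation by integral unitary `g` with integral inverse (`conj_mem_residueSquareClassPiece`) and under left multiplication by integral `u ≡ 1 (ϖ²)` (`mul_mem_residueSquareClassPiece`),
misses `1` (`one_not_mem_residueSquareClassPiece`), and misses EVERY conjugate of `n(ε c₀ ϖ)` when `|ε − σz·z| = 1` for all integral `z` (`conj_cornerUnipotent_not_mem_residueSquareClassPiece`: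
the value is `εc₀ϖ·σa·a`, and `|ε·σa·a − σy·y| = 1` in each of the cases `|a| < 1`, `|a| = 1`, `|a| > 1`).  With these five facts the ramified ‹RANK› table
`(1, tv_c, tv_εc, reg) × (1_{K(ϖ²)}, 1_{P(c)}, 1_{P(εc)}, 1_R)` is lower-triangular with a diagonal transvection block (head `UnipotentOrbitalIntegralLevelPiecesRamifiedCM`, to follow).
HONEST LABEL: HC_CM is proved only modulo the 2 remaining named inputs (hLiu418 24832, h413 24833) until rung 0 closes; place-generic algebra, count-neutral.

## References
* [Rogawski1990] J. D. Rogawski, *Automorphic Representations of Unitary Groups in Three Variables*, Ann. of Math. Stud. 123 (1990): §3.9 p. 32 (singular classes `n(t)`, `t mod N`);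
  §4.9 p. 54; §8.1 p. 114.
* [Jacobowitz1962] R. Jacobowitz, *Hermitian forms over local fields*, Amer. J. Math. 84 (1962): §5, §8 (ramified dyadic-free case: residue quadratic forms of hermitian lattices).
* [SerreLocalFields1979] J.-P. Serre, *Local Fields*, GTM 67 (1979): Ch. V §3 (norm groups of tamely ramified quadratic extensions: `N U_E = U_F²·U_F^{(1)}`).
-/

set_option autoImplicit false

noncomputable section

open scoped Matrix MatrixGroups Valued WithZero
open Matrix

namespace Literature.NumberTheory.Automorphic.UnitaryGroup

open Literature.NumberTheory.Automorphic.HermitianLattice Literature.NumberTheory.Automorphic.UnitaryLatticeTree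

variable {K : Type*} [Field K] [Valued K ℤᵐ⁰] (σ : K →+* K)

/-- `B₀` of an integral vector against a vector of level `c` has level `c` (`σ` isometric). [cite: Rogawski1990, §3.9 p. 32] -/
theorem v_B₀_three_le_of_forall_le (hvσ : ∀ a, Valued.v (σ a) = Valued.v a) {x y : Fin 3 → K} {c : ℤᵐ⁰}
    (hx : ∀ i, Valued.v (x i) ≤ 1) (hy : ∀ i, Valued.v (y i) ≤ c) : Valued.v (B₀ σ 3 x y) ≤ c := by
  rw [B₀_three_apply]
  have h : ∀ i j, Valued.v (σ (x i) * y j) ≤ c := fun i j => by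
    rw [map_mul, hvσ]
    calc Valued.v (x i) * Valued.v (y j) ≤ 1 * c := mul_le_mul' (hx i) (hy j)
      _ = c := one_mul c
  exact Valuation.map_add_le _ (Valuation.map_add_le _ (h 0 2) (h 1 1)) (h 2 0)

/-- An integral matrix maps integral vectors to integral vectors; more generally a matrix of level `c` maps `𝒪³` into vectors of level `c`. [cite: Rogawski1990, §4.9 p. 54] -/
theorem forall_v_mulVec_le_of_forall_le {M : Matrix (Fin 3) (Fin 3) K} {c : ℤᵐ⁰} (hM : ∀ a b, Valued.v (M a b) ≤ c) {x : Fin 3 → K}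
    (hx : ∀ i, Valued.v (x i) ≤ 1) (i : Fin 3) : Valued.v ((M *ᵥ x) i) ≤ c := by
  rw [Matrix.mulVec, dotProduct]
  refine Valuation.map_sum_le _ fun j _ => ?_
  rw [map_mul]
  calc Valued.v (M i j) * Valued.v (x j) ≤ c * 1 := mul_le_mul' (hM i j) (hx j)
    _ = c := mul_one c

/-- **`n(c₀ϖ)` LIES IN THE PIECE `P(c₀)`**: it is integral, of level `ϖ`, and at `x = e₂`, `y = 1` the value `B₀(e₂, (n − 1)e₂) = c₀ϖ` hits `ϖ·c₀·N(1)` exactly.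
[cite: Rogawski1990, §3.9 p. 32] -/
theorem cornerUnipotent_mem_residueSquareClassPiece {c₀ ϖ : K} (hc₀ : Valued.v c₀ = 1) (hϖ1 : Valued.v ϖ ≤ 1) (hϖ0 : ϖ ≠ 0) {u : GL (Fin 3) K}
    (hu : (u : Matrix (Fin 3) (Fin 3) K) = !![1, 0, c₀ * ϖ; 0, 1, 0; 0, 0, 1]) :
    IsIntMatrix (u : Matrix (Fin 3) (Fin 3) K) ∧ (∀ a b, Valued.v (((u : Matrix (Fin 3) (Fin 3) K) - 1) a b) ≤ Valued.v ϖ) ∧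
      ∃ x : Fin 3 → K, (∀ i, Valued.v (x i) ≤ 1) ∧ ∃ y : K, Valued.v y = 1 ∧
        Valued.v (B₀ σ 3 x (((u : Matrix (Fin 3) (Fin 3) K) - 1) *ᵥ x) - ϖ * c₀ * (σ y * y)) < Valued.v ϖ := by
  have hcϖ : Valued.v (c₀ * ϖ) ≤ Valued.v ϖ := by rw [map_mul, hc₀, one_mul]
  refine ⟨?_, ?_, Pi.single 2 1, ?_, 1, map_one _, ?_⟩
  · intro i j
    rw [hu]
    fin_cases i <;> fin_cases j <;> simp [hc₀, hϖ1]
  · intro a b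
    rw [hu]
    fin_cases a <;> fin_cases b <;> simp [hc₀]
  · intro i
    by_cases hi : i = 2
    · subst hi; simp
    · simp [hi]
  · rw [hu, cornerUnipotent_sub_one_mulVec, B₀_single_left]
    have h0 : (Pi.single 0 (c₀ * ϖ * (Pi.single (2 : Fin 3) (1 : K) : Fin 3 → K) 2) : Fin 3 → K) (Fin.rev 2) - ϖ * c₀ * (σ 1 * 1) = 0 := by
      simp [show Fin.rev (2 : Fin 3) = 0 from rfl]; ring
    rw [h0, map_zero]
    exact (Valuation.pos_iff _).2 hϖ0

/-- **`1 ∉ P(c₀)`**: at `k = 1` the value is `0` and `|0 − ϖ·c₀·σy·y| = |ϖ|` is not `< |ϖ|`. [cite: Rogawski1990, §3.9 p. 32] -/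
theorem one_not_mem_residueSquareClassPiece (hvσ : ∀ a, Valued.v (σ a) = Valued.v a) {c₀ ϖ : K} (hc₀ : Valued.v c₀ = 1) :
    ¬ ∃ x : Fin 3 → K, (∀ i, Valued.v (x i) ≤ 1) ∧ ∃ y : K, Valued.v y = 1 ∧
        Valued.v (B₀ σ 3 x ((((1 : GL (Fin 3) K) : Matrix (Fin 3) (Fin 3) K) - 1) *ᵥ x) - ϖ * c₀ * (σ y * y)) < Valued.v ϖ := by
  rintro ⟨x, -, y, hy, hlt⟩
  rw [Units.val_one, sub_self, Matrix.zero_mulVec, map_zero, zero_sub, Valuation.map_neg, map_mul, map_mul, map_mul, hvσ, hy, hc₀,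
    mul_one, mul_one, mul_one] at hlt
  exact lt_irrefl _ hlt

/-- **`P(c₀)` IS STABLE UNDER CONJUGATION BY THE HYPERSPECIAL `K`**: for `g ∈ U(σ, J₀)` integral with integral inverse, `k ∈ P(c₀) → g k g⁻¹ ∈ P(c₀)` — levels by ★
`IntMatrixLevelConjugation`, and the value at `g x` equals the value at `x` (`B₀(g x, g w) = B₀(x, w)`). [cite: Rogawski1990, §3.9 p. 32; §4.9 p. 54] -/
theorem conj_mem_residueSquareClassPiece {c₀ ϖ : K} {k g : GL (Fin 3) K} (hg : g ∈ unitaryGroupOfForm σ ((StdForm.antidiagonal 3).over K))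
    (hgi : IsIntMatrix (g : Matrix (Fin 3) (Fin 3) K)) (hgi' : IsIntMatrix ((g⁻¹ : GL (Fin 3) K) : Matrix (Fin 3) (Fin 3) K))
    (hk : IsIntMatrix (k : Matrix (Fin 3) (Fin 3) K) ∧ (∀ a b, Valued.v (((k : Matrix (Fin 3) (Fin 3) K) - 1) a b) ≤ Valued.v ϖ) ∧
      ∃ x : Fin 3 → K, (∀ i, Valued.v (x i) ≤ 1) ∧ ∃ y : K, Valued.v y = 1 ∧
        Valued.v (B₀ σ 3 x (((k : Matrix (Fin 3) (Fin 3) K) - 1) *ᵥ x) - ϖ * c₀ * (σ y * y)) < Valued.v ϖ) :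
    IsIntMatrix ((g * k * g⁻¹ : GL (Fin 3) K) : Matrix (Fin 3) (Fin 3) K) ∧
      (∀ a b, Valued.v ((((g * k * g⁻¹ : GL (Fin 3) K) : Matrix (Fin 3) (Fin 3) K) - 1) a b) ≤ Valued.v ϖ) ∧
      ∃ x : Fin 3 → K, (∀ i, Valued.v (x i) ≤ 1) ∧ ∃ y : K, Valued.v y = 1 ∧
        Valued.v (B₀ σ 3 x ((((g * k * g⁻¹ : GL (Fin 3) K) : Matrix (Fin 3) (Fin 3) K) - 1) *ᵥ x) - ϖ * c₀ * (σ y * y)) < Valued.v ϖ := by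
  obtain ⟨hki, hkl, x, hx, y, hy, hval⟩ := hk
  refine ⟨(isIntMatrix_conj_iff hgi hgi' k).2 hki, (forall_v_conj_sub_one_apply_le_iff hgi hgi' k _).2 hkl, (g : Matrix (Fin 3) (Fin 3) K) *ᵥ x,
    fun i => forall_v_mulVec_le_of_forall_le hgi hx i, y, hy, ?_⟩
  have hgg : ((g⁻¹ : GL (Fin 3) K) : Matrix (Fin 3) (Fin 3) K) * (g : Matrix (Fin 3) (Fin 3) K) = 1 := by
    rw [← Units.val_mul, inv_mul_cancel, Units.val_one]
  have hmv : ((((g * k * g⁻¹ : GL (Fin 3) K) : Matrix (Fin 3) (Fin 3) K) - 1) *ᵥ ((g : Matrix (Fin 3) (Fin 3) K) *ᵥ x)) =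
      (g : Matrix (Fin 3) (Fin 3) K) *ᵥ ((((k : Matrix (Fin 3) (Fin 3) K) - 1)) *ᵥ x) := by
    rw [coe_conj_sub_one, Matrix.mulVec_mulVec, Matrix.mul_assoc, hgg, Matrix.mul_one, ← Matrix.mulVec_mulVec]
  rw [hmv, (mem_unitaryGroupOfForm_antidiagonal_iff (σ := σ) (N := 3) g).1 hg]
  exact hval

/-- **`P(c₀)` IS STABLE UNDER LEFT MULTIPLICATION BY THE CONGRUENCE SET OF LEVEL `ϖ²`**: for `u` integral with `u ≡ 1 (ϖ²)`, `k ∈ P(c₀) → u k ∈ P(c₀)` — the value moves by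
`B₀(x, (u − 1)(k x))`, of size `≤ |ϖ|² < |ϖ|`. [cite: Rogawski1990, §4.9 p. 54] -/
theorem mul_mem_residueSquareClassPiece (hvσ : ∀ a, Valued.v (σ a) = Valued.v a) {c₀ ϖ : K} (hϖ1 : Valued.v ϖ < 1) (hϖ0 : ϖ ≠ 0) {k u : GL (Fin 3) K}
    (hui : IsIntMatrix (u : Matrix (Fin 3) (Fin 3) K)) (hu2 : ∀ a b, Valued.v (((u : Matrix (Fin 3) (Fin 3) K) - 1) a b) ≤ Valued.v ϖ ^ 2)
    (hk : IsIntMatrix (k : Matrix (Fin 3) (Fin 3) K) ∧ (∀ a b, Valued.v (((k : Matrix (Fin 3) (Fin 3) K) - 1) a b) ≤ Valued.v ϖ) ∧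
      ∃ x : Fin 3 → K, (∀ i, Valued.v (x i) ≤ 1) ∧ ∃ y : K, Valued.v y = 1 ∧
        Valued.v (B₀ σ 3 x (((k : Matrix (Fin 3) (Fin 3) K) - 1) *ᵥ x) - ϖ * c₀ * (σ y * y)) < Valued.v ϖ) :
    IsIntMatrix ((u * k : GL (Fin 3) K) : Matrix (Fin 3) (Fin 3) K) ∧
      (∀ a b, Valued.v ((((u * k : GL (Fin 3) K) : Matrix (Fin 3) (Fin 3) K) - 1) a b) ≤ Valued.v ϖ) ∧
      ∃ x : Fin 3 → K, (∀ i, Valued.v (x i) ≤ 1) ∧ ∃ y : K, Valued.v y = 1 ∧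
        Valued.v (B₀ σ 3 x ((((u * k : GL (Fin 3) K) : Matrix (Fin 3) (Fin 3) K) - 1) *ᵥ x) - ϖ * c₀ * (σ y * y)) < Valued.v ϖ := by
  obtain ⟨hki, hkl, x, hx, y, hy, hval⟩ := hk
  have hϖ2 : Valued.v ϖ ^ 2 ≤ Valued.v ϖ := by
    rw [pow_two]
    exact mul_le_of_le_one_left' hϖ1.le
  refine ⟨?_, (forall_v_mul_sub_one_apply_le_iff hu2 hki hϖ2).2 hkl, x, hx, y, hy, ?_⟩
  · rw [Units.val_mul]; exact isIntMatrix_mul hui hki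
  have hsplit : (((u * k : GL (Fin 3) K) : Matrix (Fin 3) (Fin 3) K) - 1) *ᵥ x =
      (((u : Matrix (Fin 3) (Fin 3) K) - 1)) *ᵥ ((k : Matrix (Fin 3) (Fin 3) K) *ᵥ x) + (((k : Matrix (Fin 3) (Fin 3) K) - 1)) *ᵥ x := by
    rw [Units.val_mul, Matrix.mulVec_mulVec, ← Matrix.add_mulVec]
    congr 1
    rw [Matrix.sub_mul, Matrix.one_mul]; abel
  have hsmall : Valued.v (B₀ σ 3 x ((((u : Matrix (Fin 3) (Fin 3) K) - 1)) *ᵥ ((k : Matrix (Fin 3) (Fin 3) K) *ᵥ x))) < Valued.v ϖ := by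
    refine lt_of_le_of_lt (v_B₀_three_le_of_forall_le σ hvσ hx fun i => forall_v_mulVec_le_of_forall_le hu2 (fun j => forall_v_mulVec_le_of_forall_le hki hx j) i) ?_
    rw [pow_two]
    calc Valued.v ϖ * Valued.v ϖ < Valued.v ϖ * 1 := mul_lt_mul_of_pos_left hϖ1 ((Valuation.pos_iff _).2 hϖ0)
      _ = Valued.v ϖ := mul_one _
  rw [hsplit, map_add]
  rw [show B₀ σ 3 x ((((u : Matrix (Fin 3) (Fin 3) K) - 1)) *ᵥ ((k : Matrix (Fin 3) (Fin 3) K) *ᵥ x)) +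
      B₀ σ 3 x ((((k : Matrix (Fin 3) (Fin 3) K) - 1)) *ᵥ x) - ϖ * c₀ * (σ y * y) =
      B₀ σ 3 x ((((u : Matrix (Fin 3) (Fin 3) K) - 1)) *ᵥ ((k : Matrix (Fin 3) (Fin 3) K) *ᵥ x)) +
      (B₀ σ 3 x ((((k : Matrix (Fin 3) (Fin 3) K) - 1)) *ᵥ x) - ϖ * c₀ * (σ y * y)) by ring]
  exact Valuation.map_add_lt _ hsmall hval

/-- **THE OTHER TRANSVECTION CLASS MISSES `P(c₀)`**: if `ε` is congruent to NO norm (`|ε − σz·z| = 1` for every integral `z`; at a tame-ramified place: `ε̄` a non-square), then no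
conjugate `g·n(ε c₀ ϖ)·g⁻¹` (`g ∈ U(σ, J₀)`) passes the value test of `P(c₀)`: by ★ `B₀_apply_conj_sub_one_mulVec` the value is `ε c₀ ϖ·σa·a` (`a = (g⁻¹x)₂`), and
`|ε·σa·a − σy·y| = 1` whether `|a| < 1`, `|a| = 1` (then it is `|σa·a|·|ε − N(y∕a)|`) or `|a| > 1`. [cite: Rogawski1990, §3.9 p. 32] [cite: SerreLocalFields1979, Ch. V §3] -/
theorem conj_cornerUnipotent_not_mem_residueSquareClassPiece (hvσ : ∀ a, Valued.v (σ a) = Valued.v a) {c₀ ϖ ε : K} (hc₀ : Valued.v c₀ = 1)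
    (hε : ∀ z : K, Valued.v z ≤ 1 → Valued.v (ε - σ z * z) = 1)
    {u g : GL (Fin 3) K} (hu : (u : Matrix (Fin 3) (Fin 3) K) = !![1, 0, ε * c₀ * ϖ; 0, 1, 0; 0, 0, 1])
    (hg : g ∈ unitaryGroupOfForm σ ((StdForm.antidiagonal 3).over K)) :
    ¬ ∃ x : Fin 3 → K, (∀ i, Valued.v (x i) ≤ 1) ∧ ∃ y : K, Valued.v y = 1 ∧
        Valued.v (B₀ σ 3 x ((((g * u * g⁻¹ : GL (Fin 3) K) : Matrix (Fin 3) (Fin 3) K) - 1) *ᵥ x) - ϖ * c₀ * (σ y * y)) < Valued.v ϖ := by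
  rintro ⟨x, -, y, hy, hlt⟩
  rw [B₀_apply_conj_sub_one_mulVec σ hu hg x] at hlt
  set a : K := (((g⁻¹ : GL (Fin 3) K) : Matrix (Fin 3) (Fin 3) K) *ᵥ x) 2 with ha
  have hε1 : Valued.v ε = 1 := by simpa using hε 0 (by simp)
  have hfac : ε * c₀ * ϖ * (σ a * a) - ϖ * c₀ * (σ y * y) = ϖ * c₀ * (ε * (σ a * a) - σ y * y) := by ring
  rw [hfac, map_mul, map_mul, hc₀, mul_one] at hlt
  have hlt1 : Valued.v (ε * (σ a * a) - σ y * y) < 1 := by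
    by_contra hge
    rw [not_lt] at hge
    have : Valued.v ϖ * 1 ≤ Valued.v ϖ * Valued.v (ε * (σ a * a) - σ y * y) := mul_le_mul' le_rfl hge
    rw [mul_one] at this
    exact absurd (lt_of_le_of_lt this hlt) (lt_irrefl _)
  have hNy : Valued.v (σ y * y) = 1 := by rw [map_mul, hvσ, hy, one_mul]
  have hNa : Valued.v (ε * (σ a * a)) = Valued.v a * Valued.v a := by rw [map_mul, hε1, one_mul, map_mul, hvσ]
  -- the three cases on `|a|`
  rcases lt_trichotomy (Valued.v a) 1 with ha1 | ha1 | ha1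
  · -- `|a| < 1`: `|ε N a| < 1 = |N y|`
    have hlt' : Valued.v (ε * (σ a * a)) < Valued.v (σ y * y) := by
      rw [hNa, hNy]
      calc Valued.v a * Valued.v a ≤ Valued.v a * 1 := mul_le_mul' le_rfl ha1.le
        _ < 1 := by rw [mul_one]; exact ha1
    have := Valuation.map_sub_eq_of_lt_left _ hlt'
    rw [Valuation.map_sub_swap, this, hNy] at hlt1
    exact lt_irrefl _ hlt1
  · -- `|a| = 1`: `ε N a − N y = N a · (ε − N (y∕a))`
    have ha0 : a ≠ 0 := fun h0 => by rw [h0, map_zero] at ha1; exact zero_ne_one ha1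
    have hσa0 : σ a ≠ 0 := (_root_.map_ne_zero σ).2 ha0
    have hfac2 : ε * (σ a * a) - σ y * y = σ a * a * (ε - σ (y / a) * (y / a)) := by
      rw [map_div₀]; field_simp
    have hya : Valued.v (y / a) ≤ 1 := by rw [map_div₀, hy, ha1, div_one]
    rw [hfac2, map_mul, map_mul, hvσ, ha1, one_mul, one_mul, hε (y / a) hya] at hlt1
    exact lt_irrefl _ hlt1
  · -- `|a| > 1`: `|ε N a| > 1 = |N y|`
    have hlt' : Valued.v (σ y * y) < Valued.v (ε * (σ a * a)) := by
      rw [hNa, hNy]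
      calc (1 : ℤᵐ⁰) = 1 * 1 := (mul_one 1).symm
        _ < Valued.v a * Valued.v a := mul_lt_mul'' ha1 ha1 zero_le zero_le
    have := Valuation.map_sub_eq_of_lt_left _ hlt'
    rw [this, hNa] at hlt1
    have h1 : (1 : ℤᵐ⁰) < Valued.v a * Valued.v a :=
      calc (1 : ℤᵐ⁰) = 1 * 1 := (mul_one 1).symm
        _ < Valued.v a * Valued.v a := mul_lt_mul'' ha1 ha1 zero_le zero_le
    exact absurd (h1.trans hlt1) (lt_irrefl _)

end Literature.NumberTheory.Automorphic.UnitaryGroup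

end
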